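import Literature.AlgebraicGeometry.HodgeTheory.WeilClassesFieldRationalSpan
import HarnessLib

/-!
# `W_F` depends only on the field `F`, not on its generator: change of generator for `weilClassesField`

Layer `Literature/AlgebraicGeometry/HodgeTheory`, theorem-only companion of
`WeilClassesMoonenZarhinCriterion` / `WeilClassesFieldRationalSpan`. Moonen–Zarhin, *Weil classes on
abelian varieties*, J. reine angew. Math. 496 (1998) = arXiv:alg-geom/9612017, §1, define the space
of Weil classes `W_F := ⋀^r_F V_X ⊂ H^r(X, ℚ)` and the multiplicities `n_σ = dim V^{1,0}_{ℂ,σ}`,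
`σ ∈ Σ_F = Hom(F, ℂ)`, for a SUBFIELD `F ⊂ End⁰(X)` — both are attached to the field and its
embeddings, not to a generator. On the tree's carriers (`weilClassesField A φ P r`,
`eigenMultiplicity A φ ρ`) the field is presented as `F = ℚ(φ) ≅ ℚ[T]/(P)` by ONE endomorphism `φ`
with `P(φ) = 0`, the embeddings `σ` by the complex roots `ρ = σ(φ)` of `P`, `V_{ℂ,σ}` by
`ker(φ^* - ρ)` and `⋀^r V_{ℂ,σ}` by the joint eigenclasses of the test pull-backs `(x·𝟙 + y·φ)^*`.
THIS file proves that these carriers are INDEPENDENT OF THE GENERATOR: if `ψ = S(φ) ∈ ℤ[φ]`,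
`S ∈ ℤ[T]`, is a second generator of the same field — rendered on the roots: `ρ ↦ S(ρ)` is injective
on the complex roots of `P` (for `ψ ∈ F = ℚ(φ)` the number of distinct conjugates `σ(ψ) = S(σ(φ))`
is `[ℚ(ψ):ℚ]`, so injectivity is exactly `ℚ(ψ) = F`) — then

* `eigenspace_map_one_eq_of_eq_eval₂` : `ker(ψ^* - S(ρ)) = ker(φ^* - ρ)` on `H¹(A(ℂ); ℂ)` for every
  root `ρ` of `P` (`V_{ℂ,σ}` is the same space whether computed from `σ(φ)` or from `σ(ψ)`);
* `eigenMultiplicity_eq_of_eq_eval₂` : `n_σ` is the same: `eigenMultiplicity A ψ (S(ρ)) =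
  eigenMultiplicity A φ ρ`;
* `pullbackEigenclasses_pow_eq_of_eq_eval₂` : `⋀^r V_{ℂ,σ}` is the same joint eigenclass space for
  the test pull-backs of `ψ` (character `(x + y S(ρ))^r`) and of `φ` (character `(x + yρ)^r`);
* `weilClassesField_eq_of_eq_eval₂` : **`weilClassesField A ψ Q r = weilClassesField A φ P r`** for
  any `Q ∈ ℤ[T]` whose complex roots are exactly the `S(ρ)`, `P(ρ) = 0` (e.g. the minimal polynomial
  of `ψ`).

On the way the wedge-basis description of the summands `⋀^r V_ρ`, which `WeilClassesFieldRationalSpan`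
proves inside its main proof, is exported as a lemma (`pullbackEigenclasses_pow_eq_span_wedge`: in an
eigenbasis `b` of `H¹` for `φ^*`, `pullbackEigenclasses A φ r ((x + yρ)^r)` is the span of the wedge
monomials `b_T`, `T` an `r`-set of indices all of eigenvalue `ρ`), together with the eigenspace version
(`eigenspace_eq_span_of_eigenbasis`).

Use (ring 2, `pub-hodge-ring2`, RING2-MAP §hypotheses gen 7 row R3⁺, "the converse R3⁺ ⟹ R3 needs a
change of generator of `E` on the spectral carrier (`weilClassesField A φ P` for two generators of one
field) — NOT in the tree"): the CM-field rung R3 (`WeilTypeLadder.WeilClassesCMField`) presents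
`K = ℚ(φ)` by an arbitrary generator, Deligne's carriers (`Deligne1982.IsWeilTypeCM A η R e₀ k`) by a
totally imaginary one `η`, `η̄ = -η`; with `η = S(φ)` this file identifies their Weil spaces and
multiplicities. Everything is proved; no definition, no named fact (D-0026).

## Proof

`P(φ) = 0` with `P` irreducible over `ℚ` gives an eigenbasis `b` of `H¹(A(ℂ); ℂ)` for `φ^*`,
`φ^* bᵢ = λᵢ bᵢ`, `P(λᵢ) = 0` (`exists_eigenbasis_complexBetti_one`). Endomorphisms act on `H¹` through
the ring `End A` (`hom_complexBetti_map_eval₂_one`: `S(φ)^* = S(φ^*)`), so `ψ^* bᵢ = S(λᵢ) bᵢ`: the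
SAME basis is an eigenbasis for `ψ^*`. An eigenspace of a diagonalised operator is the span of the
basis vectors of that eigenvalue, and a joint eigenclass space of the test pull-backs in degree `r` is
the span of the wedge monomials of that character (`forall_apply_eq_smul_iff_mem_span_image`, `Hʳ =
⋀ʳ H¹` by `Motives.AbelianVariety.hasExteriorCohomologyH1_complexPoints`, `map_cupPowOne`, and
`∏_{i∈T}(X + λᵢ) = (X + ρ)ʳ ⟹ λᵢ = ρ`); injectivity of `S` on the roots makes the index sets for
`(ψ, S(ρ))` and `(φ, ρ)` coincide. ∎

## References

* [MoonenZarhin1998WeilClasses] B. J. J. Moonen, Yu. G. Zarhin, *Weil classes on abelian varieties*,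
  J. reine angew. Math. 496 (1998) 83–92 = arXiv:alg-geom/9612017, §1 (definition of `W_F`, the
  multiplicities `n_σ`, the display `W_F ⊗ ℂ = ⊕_σ ⋀^r V_{ℂ,σ}`).
* [Deligne1982HodgeCycles] P. Deligne (notes by J. S. Milne), *Hodge cycles on abelian varieties*,
  LNM 900 (1982), §4 (4.4) and p. 30 (a CM field `E` presented as `E = F(η)`, `η̄ = -η`).
* [LangeBirkenhake1992] H. Lange, Ch. Birkenhake, *Complex Abelian Varieties* (1992), §1.1 (the
  rational representation of `End(X)`).
-/

noncomputable section

open CategoryTheory Polynomial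

namespace Literature.AlgebraicGeometry.HodgeTheory

section HodgeTheory

open Literature.AlgebraicTopology.SingularHomology
open Literature.AlgebraicGeometry.Motives (IsSmoothProjective)

variable {A : Motives.AbelianVariety ℂ}

/-! ### `ψ = S(φ)` acts on `H¹(A(ℂ); ℂ)` by `S(φ^*)`, with the same eigenvectors -/

/-- **`S(φ)^* = S(φ^*)` on `H¹(A(ℂ); ℂ)`**: if `ψ = S(φ)` in the ring `End A`, `S ∈ ℤ[T]`, then
`ψ^*|H¹ = S(φ^*|H¹)` (the rational representation is a ring homomorphism up to order,
`hom_complexBetti_map_eval₂_one`). [cite: LangeBirkenhake1992, §1.1 (p. 19)] -/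
theorem hom_complexBetti_map_one_of_eq_eval₂ {φ ψ : A ⟶ A} {S : Polynomial ℤ}
    (hψ : (ψ : CategoryTheory.End A) =
      Polynomial.eval₂ (Int.castRingHom (CategoryTheory.End A)) (φ : CategoryTheory.End A) S) :
    (complexBetti.map ψ.hom.hom.hom 1).hom =
      Polynomial.aeval (complexBetti.map φ.hom.hom.hom 1).hom (S.map (Int.castRingHom ℂ)) := by
  have h : ψ = End.asHom (Polynomial.eval₂ (Int.castRingHom (CategoryTheory.End A)) (End.of φ) S) := hψ
  rw [← hom_complexBetti_map_eval₂_one, h]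

/-- An eigenvector of `φ^*` on `H¹` with eigenvalue `μ` is an eigenvector of `ψ^* = S(φ)^*` with
eigenvalue `S(μ)`. [cite: LangeBirkenhake1992, §1.1 (p. 19)] -/
theorem mem_eigenspace_map_one_of_eq_eval₂ {φ ψ : A ⟶ A} {S : Polynomial ℤ}
    (hψ : (ψ : CategoryTheory.End A) =
      Polynomial.eval₂ (Int.castRingHom (CategoryTheory.End A)) (φ : CategoryTheory.End A) S)
    {μ : ℂ} {v : complexBetti A.X 1}
    (hv : v ∈ Module.End.eigenspace (complexBetti.map φ.hom.hom.hom 1).hom μ) :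
    v ∈ Module.End.eigenspace (complexBetti.map ψ.hom.hom.hom 1).hom
      (Polynomial.eval₂ (Int.castRingHom ℂ) μ S) := by
  rw [Module.End.mem_eigenspace_iff, hom_complexBetti_map_one_of_eq_eval₂ hψ]
  by_cases hv0 : v = 0
  · rw [hv0, map_zero, smul_zero]
  · rw [Module.End.aeval_apply_of_hasEigenvector (Module.End.hasEigenvector_iff.2 ⟨hv, hv0⟩),
      Polynomial.eval_map]

/-! ### Eigenspaces and joint eigenclass spaces in an eigenbasis -/

/-- **An eigenspace of a diagonalised operator is spanned by the basis vectors of that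
eigenvalue**: if `b` is a basis of `H¹(A(ℂ); ℂ)` with `T bᵢ = λᵢ bᵢ`, then
`ker(T - χ) = span {bᵢ | λᵢ = χ}`. [folklore] -/
theorem eigenspace_eq_span_of_eigenbasis {N : ℕ} (b : Module.Basis (Fin N) ℂ (complexBetti A.X 1))
    (lam : Fin N → ℂ) (T : Module.End ℂ (complexBetti A.X 1))
    (hb : ∀ i, b i ∈ Module.End.eigenspace T (lam i)) (χ : ℂ) :
    Module.End.eigenspace T χ = Submodule.span ℂ (b '' {i | lam i = χ}) := by
  ext v
  rw [Module.End.mem_eigenspace_iff]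
  have h := forall_apply_eq_smul_iff_mem_span_image (P := Unit) b (fun _ => T) (fun i _ => lam i)
    (fun _ i => Module.End.mem_eigenspace_iff.1 (hb i)) (fun _ => χ) v
  have hset : {i : Fin N | (fun _ : Unit => lam i) = fun _ => χ} = {i | lam i = χ} := by
    ext i
    simp only [Set.mem_setOf_eq]
    exact ⟨fun h => congrFun h (), fun h => funext fun _ => h⟩
  rw [hset] at h
  exact ⟨fun hv => h.1 fun _ => hv, fun hv => (h.2 hv) ()⟩

/-- **The summand `⋀ʳ V_ρ` in a wedge basis** (exported from the proof of
`weilClassesField_eq_span_isRationalClass`): if `b` is a basis of `H¹(A(ℂ); ℂ)` with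
`φ^* bᵢ = λᵢ bᵢ`, then the joint eigenclass space `pullbackEigenclasses A φ r ((x + yρ)ʳ)` of the test
pull-backs `(x·𝟙 + y·φ)^*` is the span of the wedge monomials `b_T = ⌣_{i ∈ T} bᵢ` (transported
along `Hʳ = ⋀ʳ H¹`, `Motives.AbelianVariety.hasExteriorCohomologyH1_complexPoints`) over the `r`-sets
`T` of indices with ALL eigenvalues `λᵢ = ρ` — Moonen–Zarhin's `⋀^r_ℂ V_{ℂ,σ}`: `(x·𝟙 + y·φ)^* b_T =
∏_{i∈T}(x + yλᵢ) · b_T` (`map_cupPowOne`), and `∏_{i∈T}(x + yλᵢ) = (x + yρ)ʳ` for all `x, y ∈ ℕ`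
forces `λᵢ = ρ` (`eq_of_forall_prod_natCast_add_eq_pow_card`).
[cite: MoonenZarhin1998WeilClasses, §1 (W_F ⊗ ℂ = ⊕_σ ⋀^r V_{ℂ,σ})] -/
theorem pullbackEigenclasses_pow_eq_span_wedge {N : ℕ}
    (b : Module.Basis (Fin N) ℂ (complexBetti A.X 1)) (lam : Fin N → ℂ) {φ : A ⟶ A}
    (hb : ∀ i, b i ∈ Module.End.eigenspace (complexBetti.map φ.hom.hom.hom 1).hom (lam i))
    (r : ℕ) (ρ : ℂ) :
    pullbackEigenclasses A φ r (fun x y => ((x : ℂ) + (y : ℂ) * ρ) ^ r) =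
      Submodule.span ℂ (((b.exteriorPower r).map
          ((Motives.AbelianVariety.hasExteriorCohomologyH1_complexPoints A).equiv r)) ''
        {T | ∀ i : Fin r, lam (Set.powersetCard.ofFinEmbEquiv.symm T i) = ρ}) := by
  classical
  have hΛ := Motives.AbelianVariety.hasExteriorCohomologyH1_complexPoints A
  let Bw : Module.Basis (Set.powersetCard (Fin N) r) ℂ (complexBetti A.X r) :=
    (b.exteriorPower r).map (hΛ.equiv r)
  have hBw : ∀ T, Bw T = cupPowOne ℂ (Motives.ComplexPoints A.X) r
      (b ∘ (Set.powersetCard.ofFinEmbEquiv.symm T)) := by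
    intro T
    change hΛ.equiv r ((b.exteriorPower r) T) = _
    rw [exteriorPower.basis_apply, HasExteriorCohomologyH1.equiv_apply, exteriorPower.ιMulti_family,
      wedgeToCup_ιMulti]
  have hact : ∀ (pr : ℕ × ℕ) (T : Set.powersetCard (Fin N) r),
      (complexBetti.map (pr.1 • 𝟙 A + pr.2 • φ).hom.hom.hom r).hom (Bw T) =
        (∏ i : Fin r, ((pr.1 : ℂ) + (pr.2 : ℂ) * lam (Set.powersetCard.ofFinEmbEquiv.symm T i))) •
          Bw T := by
    rintro ⟨x, y⟩ T
    rw [hBw]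
    change singularCohomology.map ℂ ℂ
      (Motives.AlgPoints.mapContinuous (L := ℂ) (x • 𝟙 A + y • φ).hom.hom.hom) r
        (cupPowOne ℂ _ r _) = _
    rw [map_cupPowOne]
    have e : (fun i => singularCohomology.map ℂ ℂ
        (Motives.AlgPoints.mapContinuous (L := ℂ) (x • 𝟙 A + y • φ).hom.hom.hom) 1
          ((b ∘ (Set.powersetCard.ofFinEmbEquiv.symm T)) i)) =
        fun i => ((x : ℂ) + (y : ℂ) * lam (Set.powersetCard.ofFinEmbEquiv.symm T i)) •
          (b ∘ (Set.powersetCard.ofFinEmbEquiv.symm T)) i := by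
      funext i
      exact complexBetti_map_nsmul_id_add_nsmul_one_of_mem_eigenspace (hb _) x y
    rw [e, MultilinearMap.map_smul_univ]
  -- the index sets: all `r` eigenvalues equal to `ρ`
  have hχ : ∀ (T : Set.powersetCard (Fin N) r),
      ((fun pr : ℕ × ℕ => ∏ i : Fin r,
          ((pr.1 : ℂ) + (pr.2 : ℂ) * lam (Set.powersetCard.ofFinEmbEquiv.symm T i))) =
        fun pr : ℕ × ℕ => ((pr.1 : ℂ) + (pr.2 : ℂ) * ρ) ^ r) ↔
        ∀ i : Fin r, lam (Set.powersetCard.ofFinEmbEquiv.symm T i) = ρ := by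
    intro T
    constructor
    · intro h i
      refine eq_of_forall_prod_natCast_add_eq_pow_card
        (v := fun i : Fin r => lam (Set.powersetCard.ofFinEmbEquiv.symm T i)) (ρ := ρ) (fun x => ?_) i
      have hx := congrFun h (x, 1)
      simp only [Nat.cast_one, one_mul] at hx
      rw [Fintype.card_fin]
      exact hx
    · intro hT
      funext pr
      rw [Finset.prod_congr rfl (fun i _ => by rw [hT i]), Finset.prod_const, Finset.card_univ,
        Fintype.card_fin]
  ext c
  rw [mem_pullbackEigenclasses_iff]
  have h2 := forall_apply_eq_smul_iff_mem_span_image (P := ℕ × ℕ) Bw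
    (fun pr => (complexBetti.map (pr.1 • 𝟙 A + pr.2 • φ).hom.hom.hom r).hom)
    (fun T pr => ∏ i : Fin r,
      ((pr.1 : ℂ) + (pr.2 : ℂ) * lam (Set.powersetCard.ofFinEmbEquiv.symm T i)))
    hact (fun pr => ((pr.1 : ℂ) + (pr.2 : ℂ) * ρ) ^ r) c
  have hs2 : {T : Set.powersetCard (Fin N) r |
      (fun pr : ℕ × ℕ => ∏ i : Fin r,
        ((pr.1 : ℂ) + (pr.2 : ℂ) * lam (Set.powersetCard.ofFinEmbEquiv.symm T i))) =
        fun pr : ℕ × ℕ => ((pr.1 : ℂ) + (pr.2 : ℂ) * ρ) ^ r} =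
      {T | ∀ i : Fin r, lam (Set.powersetCard.ofFinEmbEquiv.symm T i) = ρ} := by
    ext T
    exact hχ T
  rw [hs2] at h2
  constructor
  · intro hc
    exact h2.1 fun pr => hc pr.1 pr.2
  · intro hc x y
    exact (h2.2 hc) (x, y)

/-! ### Change of generator: `ψ = S(φ)` with `S` injective on the roots of `P` -/

/-- **`V_{ℂ,σ}` does not depend on the generator**: for `P` irreducible over `ℚ` with `P(φ) = 0` in
`End A`, `ψ = S(φ)` (`S ∈ ℤ[T]`) with `ρ ↦ S(ρ)` injective on the complex roots of `P` (i.e. `ψ`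
generates the same field `F = ℚ(φ)`), and every root `ρ`:
`ker(ψ^* - S(ρ)) = ker(φ^* - ρ)` on `H¹(A(ℂ); ℂ)`.
[cite: MoonenZarhin1998WeilClasses, §1 (the decomposition V_ℂ = ⊕_σ V_{ℂ,σ})] -/
theorem eigenspace_map_one_eq_of_eq_eval₂ {φ ψ : A ⟶ A} {P S : Polynomial ℤ}
    (hPirr : Irreducible (P.map (Int.castRingHom ℚ)))
    (hφ : Polynomial.eval₂ (Int.castRingHom (CategoryTheory.End A)) (φ : CategoryTheory.End A) P = 0)
    (hψ : (ψ : CategoryTheory.End A) =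
      Polynomial.eval₂ (Int.castRingHom (CategoryTheory.End A)) (φ : CategoryTheory.End A) S)
    (hinj : ∀ ρ ρ' : ℂ, Polynomial.eval₂ (Int.castRingHom ℂ) ρ P = 0 →
      Polynomial.eval₂ (Int.castRingHom ℂ) ρ' P = 0 →
      Polynomial.eval₂ (Int.castRingHom ℂ) ρ S = Polynomial.eval₂ (Int.castRingHom ℂ) ρ' S → ρ = ρ')
    {ρ : ℂ} (hρ : Polynomial.eval₂ (Int.castRingHom ℂ) ρ P = 0) :
    Module.End.eigenspace (complexBetti.map ψ.hom.hom.hom 1).hom (Polynomial.eval₂ (Int.castRingHom ℂ) ρ S)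
      = Module.End.eigenspace (complexBetti.map φ.hom.hom.hom 1).hom ρ := by
  obtain ⟨N, b, lam, hlamP, hb⟩ := exists_eigenbasis_complexBetti_one hPirr hφ
  have hb' : ∀ i, b i ∈ Module.End.eigenspace (complexBetti.map ψ.hom.hom.hom 1).hom
      (Polynomial.eval₂ (Int.castRingHom ℂ) (lam i) S) :=
    fun i => mem_eigenspace_map_one_of_eq_eval₂ hψ (hb i)
  rw [eigenspace_eq_span_of_eigenbasis b (fun i => Polynomial.eval₂ (Int.castRingHom ℂ) (lam i) S)
      _ hb' _, eigenspace_eq_span_of_eigenbasis b lam _ hb ρ]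
  have hset : {i : Fin N | Polynomial.eval₂ (Int.castRingHom ℂ) (lam i) S =
      Polynomial.eval₂ (Int.castRingHom ℂ) ρ S} = {i | lam i = ρ} := by
    ext i
    simp only [Set.mem_setOf_eq]
    exact ⟨fun h => hinj _ _ (hlamP i) hρ h, fun h => by rw [h]⟩
  rw [hset]

/-- **The multiplicity `n_σ` does not depend on the generator**: under the same hypotheses,
`eigenMultiplicity A ψ (S(ρ)) = eigenMultiplicity A φ ρ` at every complex root `ρ` of `P`.
[cite: MoonenZarhin1998WeilClasses, §1 (the multiplicities n_σ)] -/
theorem eigenMultiplicity_eq_of_eq_eval₂ {φ ψ : A ⟶ A} {P S : Polynomial ℤ}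
    (hPirr : Irreducible (P.map (Int.castRingHom ℚ)))
    (hφ : Polynomial.eval₂ (Int.castRingHom (CategoryTheory.End A)) (φ : CategoryTheory.End A) P = 0)
    (hψ : (ψ : CategoryTheory.End A) =
      Polynomial.eval₂ (Int.castRingHom (CategoryTheory.End A)) (φ : CategoryTheory.End A) S)
    (hinj : ∀ ρ ρ' : ℂ, Polynomial.eval₂ (Int.castRingHom ℂ) ρ P = 0 →
      Polynomial.eval₂ (Int.castRingHom ℂ) ρ' P = 0 →
      Polynomial.eval₂ (Int.castRingHom ℂ) ρ S = Polynomial.eval₂ (Int.castRingHom ℂ) ρ' S → ρ = ρ')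
    {ρ : ℂ} (hρ : Polynomial.eval₂ (Int.castRingHom ℂ) ρ P = 0) :
    eigenMultiplicity A ψ (Polynomial.eval₂ (Int.castRingHom ℂ) ρ S) = eigenMultiplicity A φ ρ := by
  unfold eigenMultiplicity
  rw [eigenspace_map_one_eq_of_eq_eval₂ hPirr hφ hψ hinj hρ]

/-- **`⋀ʳ V_{ℂ,σ}` does not depend on the generator**: under the same hypotheses, for every root `ρ`
of `P` and every degree `r`, the joint eigenclasses of the test pull-backs `(x·𝟙 + y·ψ)^*` for the
character `(x + y S(ρ))ʳ` are those of `(x·𝟙 + y·φ)^*` for `(x + yρ)ʳ`.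
[cite: MoonenZarhin1998WeilClasses, §1 (W_F ⊗ ℂ = ⊕_σ ⋀^r V_{ℂ,σ})] -/
theorem pullbackEigenclasses_pow_eq_of_eq_eval₂ {φ ψ : A ⟶ A} {P S : Polynomial ℤ}
    (hPirr : Irreducible (P.map (Int.castRingHom ℚ)))
    (hφ : Polynomial.eval₂ (Int.castRingHom (CategoryTheory.End A)) (φ : CategoryTheory.End A) P = 0)
    (hψ : (ψ : CategoryTheory.End A) =
      Polynomial.eval₂ (Int.castRingHom (CategoryTheory.End A)) (φ : CategoryTheory.End A) S)
    (hinj : ∀ ρ ρ' : ℂ, Polynomial.eval₂ (Int.castRingHom ℂ) ρ P = 0 →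
      Polynomial.eval₂ (Int.castRingHom ℂ) ρ' P = 0 →
      Polynomial.eval₂ (Int.castRingHom ℂ) ρ S = Polynomial.eval₂ (Int.castRingHom ℂ) ρ' S → ρ = ρ')
    {ρ : ℂ} (hρ : Polynomial.eval₂ (Int.castRingHom ℂ) ρ P = 0) (r : ℕ) :
    pullbackEigenclasses A ψ r
        (fun x y => ((x : ℂ) + (y : ℂ) * Polynomial.eval₂ (Int.castRingHom ℂ) ρ S) ^ r) =
      pullbackEigenclasses A φ r (fun x y => ((x : ℂ) + (y : ℂ) * ρ) ^ r) := by
  obtain ⟨N, b, lam, hlamP, hb⟩ := exists_eigenbasis_complexBetti_one hPirr hφ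
  have hb' : ∀ i, b i ∈ Module.End.eigenspace (complexBetti.map ψ.hom.hom.hom 1).hom
      (Polynomial.eval₂ (Int.castRingHom ℂ) (lam i) S) :=
    fun i => mem_eigenspace_map_one_of_eq_eval₂ hψ (hb i)
  rw [pullbackEigenclasses_pow_eq_span_wedge b (fun i => Polynomial.eval₂ (Int.castRingHom ℂ) (lam i) S)
      hb' r _, pullbackEigenclasses_pow_eq_span_wedge b lam hb r ρ]
  have hset : {T : Set.powersetCard (Fin N) r | ∀ i : Fin r,
      Polynomial.eval₂ (Int.castRingHom ℂ) (lam (Set.powersetCard.ofFinEmbEquiv.symm T i)) S =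
        Polynomial.eval₂ (Int.castRingHom ℂ) ρ S} =
      {T | ∀ i : Fin r, lam (Set.powersetCard.ofFinEmbEquiv.symm T i) = ρ} := by
    ext T
    simp only [Set.mem_setOf_eq]
    exact forall_congr' fun i => ⟨fun h => hinj _ _ (hlamP _) hρ h, fun h => by rw [h]⟩
  rw [hset]

/-- **`W_F ⊗ ℂ` does not depend on the generator** (Moonen–Zarhin attach `W_F = ⋀^r_F V_X` to the
subfield `F ⊂ End⁰(X)`): for `P` irreducible over `ℚ` with `P(φ) = 0` in `End A`, a second
generator `ψ = S(φ)` of `F = ℚ(φ)` (`S ∈ ℤ[T]` injective on the complex roots of `P`), and any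
`Q ∈ ℤ[T]` whose complex roots are exactly the numbers `S(ρ)`, `P(ρ) = 0` (e.g. the minimal
polynomial of `ψ`): `weilClassesField A ψ Q r = weilClassesField A φ P r` in every degree `r`.
[cite: MoonenZarhin1998WeilClasses, §1 (definition of W_F, W_F ⊗ ℂ = ⊕_σ ⋀^r V_{ℂ,σ})] -/
theorem weilClassesField_eq_of_eq_eval₂ {φ ψ : A ⟶ A} {P Q S : Polynomial ℤ}
    (hPirr : Irreducible (P.map (Int.castRingHom ℚ)))
    (hφ : Polynomial.eval₂ (Int.castRingHom (CategoryTheory.End A)) (φ : CategoryTheory.End A) P = 0)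
    (hψ : (ψ : CategoryTheory.End A) =
      Polynomial.eval₂ (Int.castRingHom (CategoryTheory.End A)) (φ : CategoryTheory.End A) S)
    (hinj : ∀ ρ ρ' : ℂ, Polynomial.eval₂ (Int.castRingHom ℂ) ρ P = 0 →
      Polynomial.eval₂ (Int.castRingHom ℂ) ρ' P = 0 →
      Polynomial.eval₂ (Int.castRingHom ℂ) ρ S = Polynomial.eval₂ (Int.castRingHom ℂ) ρ' S → ρ = ρ')
    (hQP : ∀ μ : ℂ, Polynomial.eval₂ (Int.castRingHom ℂ) μ Q = 0 →
      ∃ ρ : ℂ, Polynomial.eval₂ (Int.castRingHom ℂ) ρ P = 0 ∧ μ = Polynomial.eval₂ (Int.castRingHom ℂ) ρ S)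
    (hPQ : ∀ ρ : ℂ, Polynomial.eval₂ (Int.castRingHom ℂ) ρ P = 0 →
      Polynomial.eval₂ (Int.castRingHom ℂ) (Polynomial.eval₂ (Int.castRingHom ℂ) ρ S) Q = 0)
    (r : ℕ) :
    weilClassesField A ψ Q r = weilClassesField A φ P r := by
  refine le_antisymm ?_ ?_
  · refine iSup₂_le fun μ hμ => ?_
    obtain ⟨ρ, hρ, rfl⟩ := hQP μ hμ
    rw [pullbackEigenclasses_pow_eq_of_eq_eval₂ hPirr hφ hψ hinj hρ r]
    exact pullbackEigenclasses_le_weilClassesField hρ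
  · refine iSup₂_le fun ρ hρ => ?_
    rw [← pullbackEigenclasses_pow_eq_of_eq_eval₂ hPirr hφ hψ hinj hρ r]
    exact pullbackEigenclasses_le_weilClassesField (hPQ ρ hρ)

end HodgeTheory

end Literature.AlgebraicGeometry.HodgeTheory
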